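import Mathlib
import HarnessLib
import Literature.MathematicalPhysics.QuantumLattice.SectorisedKernelNormRefinementPlateauPrescribedTreeWt
import Summits.HubbardSuperconductivity.HubbardSuperconductivity.Theorems.KLProgrammeKLRegimeEngineNormsJumpResectorisationPrescribed

/-!
# Route `KLProgramme` — crux K3 ENGINE, item stmt-HubbardSuperconductivity-20437 `KLRegimeEngineV17F2`, stub (b) `stub_engine_step_norms`
# (clause (E1), blocked birth-level tower, WEIGHTED levels track): tree-weighted re-sectorisation at a jump `k → J′` with prescribed legs

Cell gate-hubbard-kl, seat hubbard-kl-k3c2-p3 (g6).  The weighted twin of `…EngineNormsJumpResectorisationPrescribed`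
(`EngineV8.hubbardSectorPrescribedSum_klAniso_jump_le_split`): the tower's norms carry a tree weight on the leg positions (`klWtPinnedSum`:
`klScaleWt … ((univ.image X).image latticeLegPos)`, an `IsTreeWeight` by `isTreeWeight_diamWeight`), and the E1 lead's prescribed-leg Grassmann
suppliers come in weighted form (`GrassmannWeighted…Prescribed`).  KL instance of
`Literature.…SectorisedKernelNormRefinementPlateauPrescribedTreeWt.hubbardSectorPrescribedSumWt_refine_le_split_of_plateau_pair_treeWt` for the plateau
pair `(klAnisoFamily k, F̃_k ; klAnisoFamily J′)`, `k + 1 ≤ J′`: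

* **`hubbardSectorPrescribedSumWt_klAniso_jump_le_split`** — for ANY tree weight `wt` and position map `g`, leg set `E ∋ p`, prescription `τ″|_E`,
  PAIR-WEIGHTED per-pair column / row sums `Σ ‖(E(klAniso J′)S(F̃_k))(…)‖·wt{g x″, g x′} ≤ c₁ / c₁r` (labels matched), split counts `R₁`/`R₂`, and
  bounds `N₁`/`N₂` on the `wt`-weighted level-`k` prescribed sums:
  `ε^m Σ_{σ″|_E = τ″|_E} Σ_{x″_p = x} wt(g(x″))‖W_{J′,σ″}(x″)‖ ≤ c₁^m · c₁r · 27^{|E|} · ε^m · (ε · (R₁N₁ + R₂N₂))`.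

The weighted overlap constants `c₁`, `c₁r` (first position moments of the overlap kernel at the weight's scale) are counting-lane inputs NOT in
the tree at this date (the unweighted ones are: `…SectorMultiplierJumpRegime.overlap_jump_sums_klEng`).  Everything is proved; no definitions;
nothing about the model is asserted beyond this implication.
-/

noncomputable section

namespace Summit.HubbardSuperconductivity.HubbardSuperconductivity.Theorems.EngineV8

set_option linter.dupNamespace false -- summit = problem name (single-conjunct summit), D-0017

open Classical
open Real Finset Literature.MathematicalPhysics.QuantumLattice Literature.Probability.LatticeModels GrassmannAlgebra
open Literature.Probability.LatticeModels.BattleFederbush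
open Summit.HubbardSuperconductivity.HubbardSuperconductivity.Theorems.KLProgrammeLegKernels
open Summit.HubbardSuperconductivity.HubbardSuperconductivity.Theorems.KLRegimeSplit
open Summit.HubbardSuperconductivity.HubbardSuperconductivity.Theorems.TorusFourierL2

variable {L M : ℕ} [NeZero L] [NeZero M] {Λ : Type*} [DecidableEq Λ] {wt : Finset Λ → ℝ}

/-- **TREE-WEIGHTED re-sectorisation at a jump with prescribed legs and the split relative count** (weights `wt((univ.image x).image g)`,
pair-weighted per-leg overlap sums `‖T‖·wt{g x″, g x′}`; otherwise verbatim the unweighted twin).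
**Unweighted twin: `hubbardSectorPrescribedSum_klAniso_jump_le_split`.** (BGM 2006 §2.8 (2.82)–(2.84), (2.88)–(2.90), App. A3 Lemma A3.1;
the LEVELS track of the blocked birth-level tower, E1-TOWER-BLOCKED §10 (Hμ-L)): for `k + 1 ≤ J′`, every Grassmann polynomial `G`, degree
`m + 1`, constraint set `A″` of `klAnisoFamily J′`-label tuples, set `E` of legs with prescribed labels `τ″|_E`, position-pinned leg `p ∈ E`,
class `B` of coarse (`klAnisoFamily k`) label tuples; given per-pair column sums `≤ c₁` and row sums `≤ c₁r` of `‖E(klAnisoFamily J′)·S(F̃_k)‖`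
(labels matched), refinement counts at fixed prescription `#{σ″ ∈ A″ : σ″|_E = τ″|_E, σ″ overlaps σ′ leg by leg} ≤ R₁` for `σ′ ∉ B`, `≤ R₂` for
`σ′ ∈ B`, and bounds `N₁` (all `σ′`) / `N₂` (`σ′ ∈ B`) on the level-`k` prescribed sums `ε^m Σ_{σ′|_E = τ′|_E} Σ_{x′_p = y} ‖W_{k,σ′}(x′)‖`:
`ε^m Σ_{σ″ ∈ A″, σ″|_E = τ″|_E} Σ_{x″_p = x} ‖W_{J′,σ″}(x″)‖ ≤ c₁^m · c₁r · 27^{|E|} · ε^m · (ε · (R₁ · N₁ + R₂ · N₂))`. -/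
theorem hubbardSectorPrescribedSumWt_klAniso_jump_le_split (hwt : IsTreeWeight wt) (g : SpaceTimeIdx L M → Λ)
    {β : ℝ} (hβ : 0 < β) (μ : ℝ) (K : TrigPolyC4v) {k J' : ℕ} (hJ : k + 1 ≤ J')
    (G : HubbardGrassmann L M) {c₁ c₁r R₁ R₂ N₁ N₂ : ℝ} (hc₁0 : 0 ≤ c₁) (hc₁r0 : 0 ≤ c₁r) (hR₁ : 0 ≤ R₁) (hR₂ : 0 ≤ R₂)
    (hN₁0 : 0 ≤ N₁) (hN₂0 : 0 ≤ N₂)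
    (hcol₁ : ∀ (ω'' : Fin (sectorCount J')) (ω' : Fin (sectorCount k)) (σ c : Fin 2) (x' : SpaceTimeIdx L M),
      ∑ x'' : SpaceTimeIdx L M, ‖(sectorAnalysisMatrix L M β (klAnisoFamily L M β μ K klE0 J') *
        sectorSubMatrix L M β (bgmFatMultiplier L M klE0 β (nambuXiCT L μ K) k)) (x'', ((ω'', σ), c)) (x', ((ω', σ), c))‖ *
          wt {g x'', g x'} ≤ c₁)
    (hrow₁ : ∀ (ω'' : Fin (sectorCount J')) (ω' : Fin (sectorCount k)) (σ c : Fin 2) (x'' : SpaceTimeIdx L M),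
      ∑ x' : SpaceTimeIdx L M, ‖(sectorAnalysisMatrix L M β (klAnisoFamily L M β μ K klE0 J') *
        sectorSubMatrix L M β (bgmFatMultiplier L M klE0 β (nambuXiCT L μ K) k)) (x'', ((ω'', σ), c)) (x', ((ω', σ), c))‖ *
          wt {g x'', g x'} ≤ c₁r)
    (m : ℕ) (A'' : Finset (Fin (m + 1) → SectorLeg (sectorCount J'))) (B : Finset (Fin (m + 1) → SectorLeg (sectorCount k)))
    (E : Finset (Fin (m + 1))) (τ'' : Fin (m + 1) → SectorLeg (sectorCount J')) (p : Fin (m + 1)) (hp : p ∈ E)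
    (hRoff : ∀ σ' : Fin (m + 1) → SectorLeg (sectorCount k), σ' ∉ B →
      (((A''.filter fun σ'' => (∀ e ∈ E, σ'' e = τ'' e) ∧ ∀ i,
          (∃ q : FreqMomentum L M, klAnisoFamily L M β μ K klE0 J' (σ'' i).1.1 q ≠ 0 ∧
            bgmFatMultiplier L M klE0 β (nambuXiCT L μ K) k (σ' i).1.1 q ≠ 0) ∧
          (σ' i).1.2 = (σ'' i).1.2 ∧ (σ' i).2 = (σ'' i).2).card : ℝ)) ≤ R₁)
    (hRon : ∀ σ' : Fin (m + 1) → SectorLeg (sectorCount k), σ' ∈ B →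
      (((A''.filter fun σ'' => (∀ e ∈ E, σ'' e = τ'' e) ∧ ∀ i,
          (∃ q : FreqMomentum L M, klAnisoFamily L M β μ K klE0 J' (σ'' i).1.1 q ≠ 0 ∧
            bgmFatMultiplier L M klE0 β (nambuXiCT L μ K) k (σ' i).1.1 q ≠ 0) ∧
          (σ' i).1.2 = (σ'' i).1.2 ∧ (σ' i).2 = (σ'' i).2).card : ℝ)) ≤ R₂)
    (hN₁ : ∀ (τ' : Fin (m + 1) → SectorLeg (sectorCount k)) (y : SpaceTimeIdx L M),
      imagTimeWeight β M ^ m *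
        ∑ σ' ∈ univ.filter (fun σ' : Fin (m + 1) → SectorLeg (sectorCount k) => ∀ e ∈ E, σ' e = τ' e),
          ∑ x' ∈ univ.filter (fun x' : Fin (m + 1) → SpaceTimeIdx L M => x' p = y),
            wt ((univ.image x').image g) * ‖sectorisedKernel L M β (klAnisoFamily L M β μ K klE0 k) G (m + 1) σ' x'‖ ≤ N₁)
    (hN₂ : ∀ (τ' : Fin (m + 1) → SectorLeg (sectorCount k)) (y : SpaceTimeIdx L M),
      imagTimeWeight β M ^ m *
        ∑ σ' ∈ B.filter (fun σ' : Fin (m + 1) → SectorLeg (sectorCount k) => ∀ e ∈ E, σ' e = τ' e),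
          ∑ x' ∈ univ.filter (fun x' : Fin (m + 1) → SpaceTimeIdx L M => x' p = y),
            wt ((univ.image x').image g) * ‖sectorisedKernel L M β (klAnisoFamily L M β μ K klE0 k) G (m + 1) σ' x'‖ ≤ N₂)
    (x : SpaceTimeIdx L M) :
    imagTimeWeight β M ^ m * ∑ σ'' ∈ A''.filter (fun σ'' => ∀ e ∈ E, σ'' e = τ'' e),
        ∑ x'' ∈ univ.filter (fun x'' : Fin (m + 1) → SpaceTimeIdx L M => x'' p = x),
          wt ((univ.image x'').image g) * ‖sectorisedKernel L M β (klAnisoFamily L M β μ K klE0 J') G (m + 1) σ'' x''‖ ≤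
      c₁ ^ m * c₁r * 27 ^ E.card * imagTimeWeight β M ^ m * (imagTimeWeight β M * (R₁ * N₁ + R₂ * N₂)) := by
  have he : (0 : ℝ) < klE0 := by norm_num [klE0]
  set F' := klAnisoFamily L M β μ K klE0 J' with hF'
  set F := klAnisoFamily L M β μ K klE0 k with hF
  set Ft := bgmFatMultiplier L M klE0 β (nambuXiCT L μ K) k with hFt
  -- the per-pair position sums for arbitrary label pairs: mismatched spin/charge entries vanish
  have hcol₁' : ∀ (ℓ'' : SectorLeg (sectorCount J')) (X' : SpaceTimeIdx L M × SectorLeg (sectorCount k)),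
      ∑ x'' : SpaceTimeIdx L M, ‖(sectorAnalysisMatrix L M β F' * sectorSubMatrix L M β Ft) (x'', ℓ'') X'‖ * wt {g x'', g X'.1} ≤ c₁ := by
    rintro ⟨⟨ω'', σ''⟩, c''⟩ ⟨x', ⟨ω', σ'⟩, c'⟩
    by_cases hlab : σ' = σ'' ∧ c' = c''
    · obtain ⟨rfl, rfl⟩ := hlab
      exact hcol₁ ω'' ω' σ' c' x'
    · refine le_of_eq_of_le (sum_eq_zero fun x'' _ => ?_) hc₁0
      rw [sectorAnalysis_mul_sectorSub_apply, if_neg (by exact hlab), norm_zero, zero_mul]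
  have hrow₁' : ∀ (X'' : SpaceTimeIdx L M × SectorLeg (sectorCount J')) (ℓ' : SectorLeg (sectorCount k)),
      ∑ x' : SpaceTimeIdx L M, ‖(sectorAnalysisMatrix L M β F' * sectorSubMatrix L M β Ft) X'' (x', ℓ')‖ * wt {g X''.1, g x'} ≤ c₁r := by
    rintro ⟨x'', ⟨ω'', σ''⟩, c''⟩ ⟨⟨ω', σ'⟩, c'⟩
    by_cases hlab : σ' = σ'' ∧ c' = c''
    · obtain ⟨rfl, rfl⟩ := hlab
      exact hrow₁ ω'' ω' σ' c' x''
    · refine le_of_eq_of_le (sum_eq_zero fun x' _ => ?_) hc₁r0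
      rw [sectorAnalysis_mul_sectorSub_apply, if_neg (by exact hlab), norm_zero, zero_mul]
  have h := hubbardSectorPrescribedSumWt_refine_le_split_of_plateau_pair_treeWt hwt g hβ F Ft
    (fun ω q => bgmFatMultiplier_mul_bgmMultiplier he β (nambuXiCT L μ K) k ω q)
    (fun q hq ω => klAnisoFamily_eq_zero_of_sum_eq_zero β μ K klE0 k q hq ω) F'
    (fun ω' q hne => sum_klAnisoFamily_eq_one_of_klAnisoFamily_ne_zero β μ K hJ ω' q hne) G
    (fun ω'' ω' => ∃ q : FreqMomentum L M, F' ω'' q ≠ 0 ∧ Ft ω' q ≠ 0)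
    (fun ω'' ω' hno q => by
      by_contra hq
      exact hno ⟨q, (mul_ne_zero_iff.1 hq).1, (mul_ne_zero_iff.1 hq).2⟩)
    hc₁0 hc₁r0 hR₁ hR₂ hN₁0 hN₂0 hcol₁' hrow₁'
    (fun ℓ'' => by convert card_parentsLeg_klAniso_le (L := L) (M := M) β μ K (Nat.le_of_succ_le hJ) ℓ'' using 4)
    m A'' B E τ'' p hp (fun σ' hσ' => by convert hRoff σ' hσ' using 4) (fun σ' hσ' => by convert hRon σ' hσ' using 4) hN₁ hN₂ x
  exact h


end Summit.HubbardSuperconductivity.HubbardSuperconductivity.Theorems.EngineV8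

end
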